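import Mathlib
import Summits.ValiantsHypothesis.ValiantsHypothesis.Theorems.TwoProducts.Negative.CommonPadding
import Summits.ValiantsHypothesis.ValiantsHypothesis.Theorems.TwoProducts.Negative.RankTwoPaddingClassCover
import Summits.ValiantsHypothesis.ValiantsHypothesis.Theorems.TwoProducts.Negative.RankTwoPaddingMergeKit
import Summits.ValiantsHypothesis.ValiantsHypothesis.Theorems.TwoProducts.Negative.FullPadding
import HarnessLib

/-!
# NEGATIVE lane (val-neg-1 g5): FULL DEEP PADDING forces (R5) and (R1_r) outright

Helper file for crux `stmt-ValiantsHypothesis-5906` (filed `--supports`; closes NO item, proves NO summit statement, does NOT prove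
`TwoProducts`, `PlanarCellBound` or VP ≠ VNP; 0 `def`s).  Sequel to `Negative/FullPadding.lean` (same seat).

For ANY letter family `M` on `m + 2g` positions carrying the gadget letters `c_i s, 2c_i s` (`c_i = 2·5^i`, `s ≠ 0`) at the paired positions
`m+i`, `m+g+i` — e.g. the `g`-pair padded family `A'` of `fullPadding_spec` (`fullPadding_letters`), or its one-sided variant:
* `fullPadding_cover_card`: EVERY cover of the coincidences of `A'` by relation classes (token-for-token the hypothesis `ClassCover` of the
  residual laws v12…v21 of `Cruxes/TwoProducts/Lines/relation_ladder.lean`) has `r ≥ g` classes — the `g` planted coincidences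
  `(2c_i s ∣ 0) ~ (c_i s ∣ c_i s)` have pairwise different difference sets;
* `fullPadding_blockSet_card`: a block `J` containing ALL gadget positions has `#blockSet A' J ≥ 5^g` — the digit tuples
  (old part `0`, pair `i` contributing `d_i c_i s`, `d_i ∈ {0,…,4}`) have pairwise different block sums (`finFunctionFinEquiv`, base 5);
* hence, under the single numeric condition `2^{m+2g} (t+2)^4 < 5^g`: `fullPadding_noSmallPermMerge` — NO lattice-small block merge of `A'`
  is of permutation type ((R5) holds for the padded instance OUTRIGHT, whatever `(u, v)` is: blocks missing a gadget position keep a planted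
  pair, blocks containing all of them are not small), and `fullPadding_noCheapCover` — EVERY class cover is expensive ((R1_r) OUTRIGHT).  [folklore]
-/

namespace Summit.ValiantsHypothesis.Theorems.TwoProducts.Negative.FullPaddingThresholds

open Finset MvPolynomial
open Summit.ValiantsHypothesis.ValiantsHypothesis.Theorems.NewtonUnitEquations.TwoProducts.FormalLogLinearisation
open Summit.ValiantsHypothesis.ValiantsHypothesis.Theorems.NewtonUnitEquations.TwoProducts.PlanarCell
open Summit.ValiantsHypothesis.ValiantsHypothesis.Theorems.NewtonUnitEquations.TwoProducts.PermutationType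
  (msetT PermType RankOneCoincidences)
open Summit.ValiantsHypothesis.Theorems.TwoProducts.Negative.CommonPadding
open Summit.ValiantsHypothesis.Theorems.TwoProducts.Negative.RankTwoPaddingMergeKit (not_permType_mergeA_of_gadget_outside)
open Summit.ValiantsHypothesis.Theorems.TwoProducts.Negative.FullPadding

variable {m g k : ℕ}

/-! ### (R1_r): every class cover has at least `g` classes -/

/-- Values of a planted tuple `single p x + single q y` (`p ≠ q`). [folklore] -/
theorem planted_apply {n : ℕ} {p q : Fin n} (hpq : p ≠ q) (x y : Expo) (j : Fin n) :
    (Pi.single p x + Pi.single q y : Fin n → Expo) j = if j = p then x else if j = q then y else 0 := by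
  classical
  simp only [Pi.add_apply, Pi.single_apply]
  by_cases hp : j = p
  · subst hp; simp [hpq]
  · by_cases hq : j = q
    · subst hq; simp [hp]
    · simp [hp, hq]

/-- **Every class cover of the padded family has `≥ g` classes.** [folklore] -/
theorem fullPadding_cover_card (M : Fin (m + (g + g)) → Finset Expo) {s : Expo} (hs0 : s ≠ 0)
    (hM : ∀ i : Fin g,
      ((2 * 5 ^ (i : ℕ)) • s ∈ M (Fin.natAdd m (Fin.castAdd g i)) ∧ (2 * (2 * 5 ^ (i : ℕ))) • s ∈ M (Fin.natAdd m (Fin.castAdd g i))) ∧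
      ((2 * 5 ^ (i : ℕ)) • s ∈ M (Fin.natAdd m (Fin.natAdd g i)) ∧ (2 * (2 * 5 ^ (i : ℕ))) • s ∈ M (Fin.natAdd m (Fin.natAdd g i))))
    {r : ℕ} (Jc : Fin r → Finset (Fin (m + (g + g)))) (ac bc : Fin r → Fin (m + (g + g)) → Expo)
    (hcov : ∀ a ∈ tuples M, ∀ b ∈ tuples M, a ≠ b → ∑ j, a j = ∑ j, b j →
      ∃ k : Fin r, (∀ j, a j ≠ b j ↔ j ∈ Jc k) ∧
        ((∀ j ∈ Jc k, a j = ac k j ∧ b j = bc k j) ∨ (∀ j ∈ Jc k, a j = bc k j ∧ b j = ac k j))) :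
    g ≤ r := by
  classical
  -- the planted pair of gadget `i`
  have hpl : ∀ i : Fin g, ∃ k : Fin r, ∀ j : Fin (m + (g + g)),
      (Pi.single (Fin.natAdd m (Fin.castAdd g i)) ((2 * (2 * 5 ^ (i : ℕ))) • s) +
          Pi.single (Fin.natAdd m (Fin.natAdd g i)) (0 : Expo) : Fin (m + (g + g)) → Expo) j ≠
        (Pi.single (Fin.natAdd m (Fin.castAdd g i)) ((2 * 5 ^ (i : ℕ)) • s) +
          Pi.single (Fin.natAdd m (Fin.natAdd g i)) ((2 * 5 ^ (i : ℕ)) • s) : Fin (m + (g + g)) → Expo) j ↔ j ∈ Jc k := by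
    intro i
    obtain ⟨⟨l1, l2⟩, ⟨m1, -⟩⟩ := hM i
    obtain ⟨ha, hb, hsum, -, -, hne⟩ := planted_pair (A := M) (gadget_pos_ne (m := m) i) hs0 (scale_ne_zero i) l1 l2 m1
    obtain ⟨k, hk, -⟩ := hcov _ ha _ hb (fun h => hne (by rw [h])) hsum
    exact ⟨k, hk⟩
  choose kc hkc using hpl
  -- gadget `i`'s first position lies in its class and in no other gadget's class
  have hin : ∀ i : Fin g, Fin.natAdd m (Fin.castAdd g i) ∈ Jc (kc i) := by
    intro i
    rw [← hkc i, planted_apply (gadget_pos_ne i), planted_apply (gadget_pos_ne i), if_pos rfl, if_pos rfl]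
    exact nsmul_ne_nsmul hs0 (by have := scale_ne_zero (i : ℕ); omega)
  have hout : ∀ i i' : Fin g, i' ≠ i → Fin.natAdd m (Fin.castAdd g i') ∉ Jc (kc i) := by
    intro i i' h
    have hne1 : (Fin.natAdd m (Fin.castAdd g i') : Fin (m + (g + g))) ≠ Fin.natAdd m (Fin.natAdd g i) := by
      intro h'
      rw [Fin.ext_iff, Fin.val_natAdd, Fin.val_natAdd, Fin.val_castAdd, Fin.val_natAdd] at h'
      omega
    have hne2 : (Fin.natAdd m (Fin.castAdd g i') : Fin (m + (g + g))) ≠ Fin.natAdd m (Fin.castAdd g i) := by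
      intro h'
      exact h (Fin.castAdd_injective _ _ (Fin.natAdd_injective _ _ h'))
    rw [← hkc i, planted_apply (gadget_pos_ne i), planted_apply (gadget_pos_ne i), if_neg hne2, if_neg hne1,
      if_neg hne2, if_neg hne1]
    exact fun h' => h' rfl
  have hinj : Function.Injective kc := by
    intro i i' h
    by_contra hii
    exact hout i' i hii (h ▸ hin i)
  simpa using Fintype.card_le_of_injective kc hinj

/-! ### (R5): a block containing all gadget positions has at least `5^g` block sums -/

/-- Block sum of an appended tuple: old part plus appended part, each over the positions of the block. [folklore] -/
theorem blockSum_append' (a : Fin m → Expo) (c : Fin k → Expo) (J : Finset (Fin (m + k))) :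
    ∑ j ∈ J, Fin.append a c j =
      ∑ j ∈ Finset.univ.filter (fun j : Fin m => Fin.castAdd k j ∈ J), a j +
        ∑ x ∈ Finset.univ.filter (fun x : Fin k => Fin.natAdd m x ∈ J), c x := by
  classical
  have h1 : ∑ j ∈ J, Fin.append a c j = ∑ j, if j ∈ J then Fin.append a c j else 0 := by
    rw [← Finset.sum_filter]; simp
  rw [h1, Fin.sum_univ_add, Finset.sum_filter, Finset.sum_filter]
  simp only [Fin.append_left, Fin.append_right]

/-- **Digit tuples: `#blockSet A' J ≥ 5^g` for every block `J` containing all gadget positions.** [folklore] -/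
theorem fullPadding_blockSet_card (M : Fin (m + (g + g)) → Finset Expo) {s : Expo} (hs0 : s ≠ 0)
    (hM : ∀ i : Fin g,
      ((2 * 5 ^ (i : ℕ)) • s ∈ M (Fin.natAdd m (Fin.castAdd g i)) ∧ (2 * (2 * 5 ^ (i : ℕ))) • s ∈ M (Fin.natAdd m (Fin.castAdd g i))) ∧
      ((2 * 5 ^ (i : ℕ)) • s ∈ M (Fin.natAdd m (Fin.natAdd g i)) ∧ (2 * (2 * 5 ^ (i : ℕ))) • s ∈ M (Fin.natAdd m (Fin.natAdd g i))))
    (J : Finset (Fin (m + (g + g)))) (hall : ∀ x : Fin (g + g), Fin.natAdd m x ∈ J) :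
    5 ^ g ≤ (blockSet M J).card := by
  classical
  -- digit tuple of `f : Fin g → Fin 5`: pair `i` carries `(min d 2 · c_i s, (d - 2) · c_i s)`, `d = f i`
  let tup : (Fin g → Fin 5) → Fin (m + (g + g)) → Expo := fun f =>
    Fin.append (0 : Fin m → Expo)
      (Fin.append (fun i : Fin g => (min (f i : ℕ) 2 * (2 * 5 ^ (i : ℕ))) • s)
        (fun i : Fin g => (((f i : ℕ) - 2) * (2 * 5 ^ (i : ℕ))) • s))
  -- membership of a digit letter `e · c_i s`, `e ≤ 2`
  have hdig : ∀ (i : Fin g) (e : ℕ), e ≤ 2 → ∀ X : Finset Expo,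
      (2 * 5 ^ (i : ℕ)) • s ∈ X → (2 * (2 * 5 ^ (i : ℕ))) • s ∈ X → (e * (2 * 5 ^ (i : ℕ))) • s ∈ insert (0 : Expo) X := by
    intro i e he X h1 h2
    rcases Nat.lt_or_ge e 1 with h | h
    · have : e = 0 := by omega
      subst this; simp
    rcases Nat.lt_or_ge e 2 with h' | h'
    · have : e = 1 := by omega
      subst this; rw [one_mul]; exact Finset.mem_insert_of_mem h1
    · have : e = 2 := by omega
      subst this; exact Finset.mem_insert_of_mem h2
  have htup : ∀ f, tup f ∈ tuples M := by
    intro f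
    rw [tuples, Fintype.mem_piFinset]
    intro j
    induction j using Fin.addCases with
    | left j => simp [tup]
    | right x =>
      induction x using Fin.addCases with
      | left i =>
        have := hdig i (min (f i : ℕ) 2) (Nat.min_le_right _ _) _ (hM i).1.1 (hM i).1.2
        simpa only [tup, Fin.append_right, Fin.append_left] using this
      | right i =>
        have := hdig i ((f i : ℕ) - 2) (by have := (f i).isLt; omega) _ (hM i).2.1 (hM i).2.2
        simpa only [tup, Fin.append_right] using this
  -- block sum of a digit tuple
  have hsum : ∀ f, ∑ j ∈ J, tup f j = (2 * (finFunctionFinEquiv f : ℕ)) • s := by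
    intro f
    rw [blockSum_append', Finset.filter_true_of_mem (fun x _ => hall x), Fin.sum_univ_add]
    simp only [Pi.zero_apply, Finset.sum_const_zero, zero_add, Fin.append_left, Fin.append_right,
      ← Finset.sum_add_distrib, ← add_nsmul]
    rw [← Finset.sum_smul, finFunctionFinEquiv_apply, Finset.mul_sum]
    congr 1
    refine Finset.sum_congr rfl fun i _ => ?_
    have := (f i).isLt
    have hmin : min (f i : ℕ) 2 + ((f i : ℕ) - 2) = f i := by omega
    calc min (f i : ℕ) 2 * (2 * 5 ^ (i : ℕ)) + ((f i : ℕ) - 2) * (2 * 5 ^ (i : ℕ))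
        = (min (f i : ℕ) 2 + ((f i : ℕ) - 2)) * (2 * 5 ^ (i : ℕ)) := by ring
      _ = 2 * ((f i : ℕ) * 5 ^ (i : ℕ)) := by rw [hmin]; ring
  -- the map `f ↦ block sum of tup f` is injective into the block set
  have hmaps : ∀ f ∈ (Finset.univ : Finset (Fin g → Fin 5)), (fun f => ∑ j ∈ J, tup f j) f ∈ blockSet M J := by
    intro f _
    rw [blockSet, Finset.mem_image]
    exact ⟨tup f, htup f, rfl⟩
  have hinj : Set.InjOn (fun f : Fin g → Fin 5 => ∑ j ∈ J, tup f j) ↑(Finset.univ : Finset (Fin g → Fin 5)) := by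
    intro f _ f' _ h
    simp only [hsum] at h
    by_contra hne
    have hne' : (finFunctionFinEquiv f : ℕ) ≠ finFunctionFinEquiv f' := by
      intro h'
      exact hne (finFunctionFinEquiv.injective (Fin.ext h'))
    exact nsmul_ne_nsmul hs0 (by omega) h
  have := Finset.card_le_card_of_injOn _ hmaps hinj
  simpa using this

/-! ### (R5) outright under the numeric condition -/

/-- **No lattice-small block merge of the padded family is of permutation type**, whenever `2^{m+2g} (t+2)^4 < 5^g`. [folklore] -/
theorem fullPadding_noSmallPermMerge {t : ℕ} (M : Fin (m + (g + g)) → Finset Expo) {s : Expo} (hs0 : s ≠ 0)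
    (hM : ∀ i : Fin g,
      ((2 * 5 ^ (i : ℕ)) • s ∈ M (Fin.natAdd m (Fin.castAdd g i)) ∧ (2 * (2 * 5 ^ (i : ℕ))) • s ∈ M (Fin.natAdd m (Fin.castAdd g i))) ∧
      ((2 * 5 ^ (i : ℕ)) • s ∈ M (Fin.natAdd m (Fin.natAdd g i)) ∧ (2 * (2 * 5 ^ (i : ℕ))) • s ∈ M (Fin.natAdd m (Fin.natAdd g i))))
    (hC : 2 ^ (m + (g + g)) * (t + 2) ^ 4 < 5 ^ g) :
    ∀ (J : Finset (Fin (m + (g + g)))) (j₀ : Fin (m + (g + g))), j₀ ∈ J →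
      BlockSmall M J (2 ^ (m + (g + g)) * (t + 2) ^ 4) → ¬ PermType (mergeA M J j₀) := by
  classical
  intro J j₀ hj₀ hsmall
  by_cases hall : ∀ x : Fin (g + g), Fin.natAdd m x ∈ J
  · -- all gadget positions in the block: the block is not small
    exfalso
    obtain ⟨P, hPcard, hPmem⟩ := hsmall
    have hsub : blockSet M J ⊆ P := by
      intro β hβ
      rw [blockSet, Finset.mem_image] at hβ
      obtain ⟨a, ha, rfl⟩ := hβ
      exact hPmem a ha
    have := fullPadding_blockSet_card M hs0 hM J hall
    have := Finset.card_le_card hsub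
    omega
  · obtain ⟨x, hx⟩ := not_forall.mp hall
    induction x using Fin.addCases with
    | left i =>
      obtain ⟨⟨l1, -⟩, ⟨m1, m2⟩⟩ := hM i
      exact not_permType_mergeA_of_gadget_outside _ J hj₀ hx (gadget_pos_ne i).symm hs0 (scale_ne_zero i) l1 m1 m2
    | right i =>
      obtain ⟨⟨l1, l2⟩, ⟨m1, -⟩⟩ := hM i
      exact not_permType_mergeA_of_gadget_outside _ J hj₀ hx (gadget_pos_ne i) hs0 (scale_ne_zero i) m1 l1 l2

/-! ### (R1_r) outright under the numeric condition -/

/-- **Every class cover of the padded family is expensive**, whenever `2^{m+2g} (t+2)^4 < 5^g`. [folklore] -/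
theorem fullPadding_noCheapCover {t : ℕ} (M : Fin (m + (g + g)) → Finset Expo) {s : Expo} (hs0 : s ≠ 0)
    (hM : ∀ i : Fin g,
      ((2 * 5 ^ (i : ℕ)) • s ∈ M (Fin.natAdd m (Fin.castAdd g i)) ∧ (2 * (2 * 5 ^ (i : ℕ))) • s ∈ M (Fin.natAdd m (Fin.castAdd g i))) ∧
      ((2 * 5 ^ (i : ℕ)) • s ∈ M (Fin.natAdd m (Fin.natAdd g i)) ∧ (2 * (2 * 5 ^ (i : ℕ))) • s ∈ M (Fin.natAdd m (Fin.natAdd g i))))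
    (hC : 2 ^ (m + (g + g)) * (t + 2) ^ 4 < 5 ^ g) :
    ∀ (r : ℕ) (Jc : Fin r → Finset (Fin (m + (g + g)))) (ac bc : Fin r → Fin (m + (g + g)) → Expo),
      (∀ a ∈ tuples M, ∀ b ∈ tuples M, a ≠ b → ∑ j, a j = ∑ j, b j →
        ∃ k : Fin r, (∀ j, a j ≠ b j ↔ j ∈ Jc k) ∧
          ((∀ j ∈ Jc k, a j = ac k j ∧ b j = bc k j) ∨ (∀ j ∈ Jc k, a j = bc k j ∧ b j = ac k j))) →
      2 ^ (m + (g + g)) * (t + 2) ^ 4 <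
        2 * (m + (g + g) + 1) * (3 * (2 + (m + (g + g)) + (m + (g + g)).choose 2) ^ 2) ^ r := by
  intro r Jc ac bc hcov
  have hgr : g ≤ r := fullPadding_cover_card M hs0 hM Jc ac bc hcov
  have hX : 5 ≤ 3 * (2 + (m + (g + g)) + (m + (g + g)).choose 2) ^ 2 := by
    have h2 : 2 ≤ 2 + (m + (g + g)) + (m + (g + g)).choose 2 := by omega
    calc 5 ≤ 3 * 2 ^ 2 := by norm_num
      _ ≤ 3 * (2 + (m + (g + g)) + (m + (g + g)).choose 2) ^ 2 := Nat.mul_le_mul_left _ (Nat.pow_le_pow_left h2 2)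
  calc 2 ^ (m + (g + g)) * (t + 2) ^ 4 < 5 ^ g := hC
    _ ≤ (3 * (2 + (m + (g + g)) + (m + (g + g)).choose 2) ^ 2) ^ g := Nat.pow_le_pow_left hX g
    _ ≤ (3 * (2 + (m + (g + g)) + (m + (g + g)).choose 2) ^ 2) ^ r := Nat.pow_le_pow_right (by omega) hgr
    _ ≤ 2 * (m + (g + g) + 1) * (3 * (2 + (m + (g + g)) + (m + (g + g)).choose 2) ^ 2) ^ r :=
        Nat.le_mul_of_pos_left _ (by positivity)

end Summit.ValiantsHypothesis.Theorems.TwoProducts.Negative.FullPaddingThresholds
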